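import Mathlib.Algebra.BigOperators.Fin
import Mathlib.Algebra.Order.Field.Basic
import Mathlib.Data.Fin.Tuple.Basic
import Mathlib.Data.Fintype.BigOperators
import Mathlib.Data.Nat.Log
import Mathlib.Tactic.FieldSimp
import Mathlib.Tactic.GCongr
import Mathlib.Tactic.Linarith
import Mathlib.Tactic.NormNum
import Mathlib.Tactic.Positivity
import Mathlib.Tactic.Ring
import Literature.Computability.Complexity.CircuitClasses
import Literature.Computability.Complexity.CircuitComposition
import Literature.Computability.Complexity.ProbabilisticClasses
import HarnessLib

/-!
# Adleman's theorem `BPP ⊆ P/poly`: the circuit half, proved (trunk CplxCore)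

Discharge programme for the named fact `Literature.Computability.Complexity.BPP_subset_PPoly`
(`Literature.Computability.Complexity.CircuitClasses`; Adleman 1978, Arora–Barak 2009,
Thm. 7.14). The textbook proof has two ingredients: (i) `P ⊆ P/poly` (Arora–Barak Thm. 6.6,
the named fact `Literature.Computability.Complexity.P_subset_PPoly`, a Turing-machine-to-circuit simulation), and
(ii) Adleman's argument proper — error reduction, the union bound over the `2ⁿ` inputs of a
given length, and hardwiring one good coin string into the circuit. This file proves (ii) in
full, in the sharper operator form

* `bp_PPoly_subset_PPoly : bp PPoly ⊆ PPoly` (`BP·(P/poly) = P/poly`),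

and deduces the relative form of Adleman's theorem

* `BPP_subset_PPoly_of_P_subset_PPoly : P_subset_PPoly → BPP_subset_PPoly`

(`BPP = bp P ⊆ bp PPoly ⊆ PPoly` by `bp_mono`). The absolute discharge
`BPP_subset_PPoly_holds` is then a one-liner from `P_subset_PPoly_holds` once (i) lands.

## Proof architecture (Arora–Barak 2009, proof of Thm. 7.14, p. 136, with Thm. 7.10 replaced by
recursive majority)

Fix `L ∈ bp PPoly`: a language `L' ∈ P/poly` (circuits of size `q`), a coin polynomial `p`,
and for every input `x` of length `n` at least `2/3` of the coin strings `y ∈ {0,1}^{p(n)}` give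
the right verdict `[⟨x,y⟩ ∈ L'] = [x ∈ L]`.

1. *Circuits on pairs* (`exists_cktSize_boolPair_of_mem_PPoly`): the map
   `(x, y) ↦ [boolPair x y ∈ L']` on `n + m` input bits has a `B₂`-circuit of size
   `N + q(N)`, `N = 2n + 2 + m`, because every bit of `boolPair x y` is an input bit or a
   constant (`pairVec`, `ofFn_pairVec`).
2. *Error reduction without Chernoff* (`recMaj`, `cktSize_recMaj`, `err_succ_le`, `err_le`):
   instead of the majority of `O(n)` independent runs (Arora–Barak Thm. 7.10, Chernoff bound)
   we iterate the majority of *three* independent copies. One round maps error `e` to at most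
   `e²(3 - 2e)` (exact count of the bad triples, `card_maj3_wrong_le`) and costs a factor `3`
   in size plus `4` gates; from `e₀ ≤ 1/3` three rounds give `e₃ ≤ 1/6` and afterwards the
   error squares, `3·e₃₊ⱼ ≤ 2^{-2^j}` (`err_bound_of_rec`). With `j = ⌊log₂ n⌋ + 1`
   (`2^j > n`) the depth is `O(log n)` and the size factor `3^{3+j} ≤ 27·(2n+2)²` is polynomial.
3. *Union bound* (`exists_forall_notMem_of_small`): summing over the `2ⁿ ≤ 2^{2^j}` inputs,
   fewer than all coin vectors are bad for some input, so one coin vector `ω` is good for every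
   input of length `n` (Arora–Barak, proof of Thm. 7.14 verbatim).
4. *Hardwiring* (`CktSize.hardwire`, `CktSize.toCircuit`): substituting the constants `ω` for
   the coin inputs costs two constant gates; the resulting family decides `L` with size
   `≤ 27 (2n+2)² (N + q(N) + 2)`, a polynomial in `n` (`Polynomial.comp`).

All circuit constructions go through the gate-list calculus `CktSize` of
`Literature.Computability.Complexity.CircuitComposition` (composition, bundling, rewiring).

## References

* L. Adleman, *Two theorems on random polynomial time*, 19th FOCS (1978), 75–83,
  doi:10.1109/SFCS.1978.37 (the theorem; original proof for `RP`).
* S. Arora, B. Barak, *Computational Complexity: A Modern Approach*, CUP 2009, Thm. 7.14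
  (`BPP ⊆ P/poly`, p. 136), Thm. 7.10 (error reduction), Thm. 6.6 (`P ⊆ P/poly`),
  Def. 6.1–6.5.
* H. Vollmer, *Introduction to Circuit Complexity*, Springer 1999, §1.2 (composition of
  circuits).

Mathlib has no Boolean circuits or probabilistic classes; we use `Finset.card_equiv`,
`Fintype.card_piFinset`, `Nat.log`, `Polynomial.eval_comp`. Everything is in
`namespace Literature.CplxCore`.
-/

namespace Literature.Computability.Complexity

open Finset GateList Polynomial

variable {ι α β γ : Type*}

/-! ### From circuits to gate lists -/

/-- A circuit over `B` realizes its own function with `C.size` gates (converse of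
`CktSize.toCircuit`; Arora–Barak 2009, Rem. 6.4: circuits are straight-line programs).
[cite: AroraBarakCC2009, Rem. 6.4] -/
theorem Circuit.cktSize_eval {B : Set GateFn} (C : Circuit ι) (hC : C.IsOver B) :
    CktSize B (fun x (_ : Unit) => C.eval x) C.size := by
  refine ⟨C.gates, fun _ => C.output, le_rfl,
    ⟨wf_gates C, hC, fun _ m hm => C.wf_output m hm, ?_⟩⟩
  intro x _
  show wireOf x (vals C.gates x) C.output = C.eval x
  unfold Circuit.eval
  cases C.output <;> rfl

/-- A circuit family deciding `L`, evaluated on a bit vector `u : Fin N → Bool`, returns the bit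
`[List.ofFn u ∈ L]` (Arora–Barak 2009, Def. 6.2; transport along `|ofFn u| = N`).
[cite: AroraBarakCC2009, Def. 6.2] -/
theorem CircuitFamily.Decides.eval_eq {C : CircuitFamily} {L : Language Bool} (h : C.Decides L)
    {N : ℕ} (u : Fin N → Bool) : (C N).eval u = L.boolIndicator (List.ofFn u) := by
  have key : ∀ (z : List Bool) (N : ℕ) (hz : z.length = N),
      (C N).eval (fun i => z.get (i.cast hz.symm)) = L.boolIndicator z := by
    rintro z _ rfl
    exact h z
  have := key (List.ofFn u) N (List.length_ofFn ..)
  simpa using this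

/-! ### Majority of three -/

/-- The majority of three bits, as the `B₂`-formula `(a ∧ b) ∨ ((a ∨ b) ∧ c)`
(Vollmer 1999, Def. 1.9, `MAJ₃`). [cite: Vollmer1999, Def. 1.9] -/
def maj3 (a b c : Bool) : Bool := (a && b) || ((a || b) && c)

/-- The majority of three input bits costs `4` gates over `B₂` (Vollmer 1999, §1.2).
[cite: Vollmer1999, §1.2] -/
theorem cktSize_maj3 (a b c : ι) :
    CktSize B2 (fun (x : ι → Bool) (_ : Unit) => maj3 (x a) (x b) (x c)) 4 := by
  have h1 : CktSize B2 (fun (x : ι → Bool) =>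
      Sum.elim x (Sum.elim (fun (_ : Unit) => (x a && x b)) (fun (_ : Unit) => (x a || x b))))
      (0 + (1 + 1)) :=
    (CktSize.id B2).pair ((cktSize_and a b).pair (cktSize_or a b))
  have h2 : CktSize B2 (fun (y : ι ⊕ (Unit ⊕ Unit) → Bool) =>
      Sum.elim (fun (_ : Unit) => y (.inr (.inl ())))
        (fun (_ : Unit) => (y (.inr (.inr ())) && y (.inl c)))) (0 + 1) :=
    (CktSize.proj B2 (fun _ : Unit => (Sum.inr (Sum.inl ()) : ι ⊕ (Unit ⊕ Unit)))).pair
      (cktSize_and _ _)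
  have h3 : CktSize B2 (fun (z : Unit ⊕ Unit → Bool) (_ : Unit) => (z (.inl ()) || z (.inr ())))
      1 := cktSize_or _ _
  exact ((h1.comp h2).comp h3).congr fun x _ => by simp [maj3]

/-! ### The pairing `boolPair` at the level of bit vectors -/

/-- Doubling every bit doubles the length: `|x.flatMap (b ↦ [b, b])| = 2|x|` (the first field
of `boolPair`; Arora–Barak 2009, §0.1). [cite: AroraBarakCC2009, §0.1] -/
theorem length_flatMap_dup (x : List Bool) :
    (x.flatMap fun b => [b, b]).length = 2 * x.length := by
  induction x with
  | nil => rfl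
  | cons b x ih => simp only [List.flatMap_cons, List.cons_append, List.nil_append,
      List.length_cons, ih]; omega

/-- Bit `i` of `x.flatMap (b ↦ [b, b])` is bit `i / 2` of `x` (Arora–Barak 2009, §0.1, the
pairing `⟨x, y⟩`). [cite: AroraBarakCC2009, §0.1] -/
theorem getElem_flatMap_dup (x : List Bool) (i : ℕ)
    (hi : i < (x.flatMap fun b => [b, b]).length) :
    (x.flatMap fun b => [b, b])[i] = x[i / 2]'(by have := length_flatMap_dup x; omega) := by
  induction x generalizing i with
  | nil => simp at hi
  | cons b x ih =>
    match i, hi with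
    | 0, _ => simp
    | 1, _ => simp
    | i + 2, hi =>
      simp only [List.flatMap_cons, List.cons_append, List.nil_append,
        List.getElem_cons_succ]
      have e : (i + 2) / 2 = i / 2 + 1 := by omega
      simp only [e, List.getElem_cons_succ]
      exact ih i _

/-- The bit vector of `boolPair (ofFn u) (ofFn v)` on `2n + 2 + m` positions: the bits of `u`
doubled, then the separator `0, 1`, then `v` (Arora–Barak 2009, §0.1).
[cite: AroraBarakCC2009, §0.1] -/
def pairVec {n m : ℕ} (u : Fin n → Bool) (v : Fin m → Bool) : Fin (2 * n + 2 + m) → Bool :=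
  Fin.append (Fin.append (fun i : Fin (2 * n) => u ⟨(i : ℕ) / 2, by have := i.2; omega⟩)
    ![false, true]) v

/-- The doubled block of `pairVec` lists as `(ofFn u).flatMap (b ↦ [b, b])` (Arora–Barak 2009,
§0.1). [cite: AroraBarakCC2009, §0.1] -/
theorem ofFn_dup {n : ℕ} (u : Fin n → Bool) :
    (List.ofFn fun i : Fin (2 * n) => u ⟨(i : ℕ) / 2, by have := i.2; omega⟩) =
      (List.ofFn u).flatMap fun b => [b, b] := by
  apply List.ext_getElem
  · rw [length_flatMap_dup]; simp
  · intro i h1 h2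
    rw [getElem_flatMap_dup]
    simp

/-- `pairVec u v` is the bit vector of the string `boolPair (ofFn u) (ofFn v)` (Arora–Barak
2009, §0.1). [cite: AroraBarakCC2009, §0.1] -/
theorem ofFn_pairVec {n m : ℕ} (u : Fin n → Bool) (v : Fin m → Bool) :
    List.ofFn (pairVec u v) = boolPair (List.ofFn u) (List.ofFn v) := by
  simp only [pairVec, List.ofFn_fin_append, ofFn_dup, boolPair]
  simp [List.ofFn_succ]

/-- Wiring the pairing `(u, v) ↦ pairVec u v` costs at most one (constant) gate per output bit:
size `≤ 2n + 2 + m` over `B₂` (projections are free, Vollmer 1999, §1.1).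
[cite: Vollmer1999, §1.1] -/
theorem cktSize_pairVec (n m : ℕ) :
    CktSize B2 (fun (w : Fin n ⊕ Fin m → Bool) =>
      pairVec (fun i => w (.inl i)) (fun j => w (.inr j))) (2 * n + 2 + m) := by
  have key : ∀ k : Fin (2 * n + 2 + m),
      CktSize B2 (fun (w : Fin n ⊕ Fin m → Bool) (_ : Unit) =>
        pairVec (fun i => w (.inl i)) (fun j => w (.inr j)) k) 1 := by
    intro k
    refine Fin.addCases (fun k₁ => ?_) (fun j => ?_) k
    · refine Fin.addCases (fun i => ?_) (fun t => ?_) k₁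
      · refine ((CktSize.proj B2 fun _ : Unit =>
          (Sum.inl ⟨(i : ℕ) / 2, by have := i.2; omega⟩ : Fin n ⊕ Fin m)).of_le
            zero_le_one).congr ?_
        intro w _
        simp only [pairVec, Fin.append_left]
      · refine (cktSize_const _ (![false, true] t)).congr ?_
        intro w _
        simp only [pairVec, Fin.append_left, Fin.append_right]
    · refine ((CktSize.proj B2 fun _ : Unit => (Sum.inr j : Fin n ⊕ Fin m)).of_le
        zero_le_one).congr ?_
      intro w _
      simp only [pairVec, Fin.append_right]
  simpa using CktSize.pi_const key

/-- **Step 1.** Unpacking `L' ∈ P/poly` on paired inputs `⟨x, y⟩`, `|x| = n`, `|y| = m`: the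
map `(x, y) ↦ [boolPair x y ∈ L']` has `B₂`-circuits of size `N + q(N)`, `N = 2n + 2 + m`,
where `q` bounds the circuit family for `L'` (Arora–Barak 2009, Def. 6.5 and proof of
Thm. 7.14, "a circuit that on input `x` outputs `M(x, r)`"). [cite: AroraBarakCC2009, Thm. 7.14] -/
theorem exists_cktSize_boolPair_of_mem_PPoly {L' : Language Bool} (hL' : L' ∈ PPoly) :
    ∃ q : Polynomial ℕ, ∀ n m : ℕ,
      CktSize B2 (fun (w : Fin n ⊕ Fin m → Bool) (_ : Unit) =>
        L'.boolIndicator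
          (boolPair (List.ofFn fun i => w (.inl i)) (List.ofFn fun j => w (.inr j))))
        ((2 * n + 2 + m) + q.eval (2 * n + 2 + m)) := by
  obtain ⟨q, C, hC, hdec⟩ : ∃ q : Polynomial ℕ, ∃ C : CircuitFamily,
      (∀ n, (C n).IsOver B2 ∧ (C n).size ≤ q.eval n) ∧ C.Decides L' := by
    simpa [PPoly, SIZE] using hL'
  refine ⟨q, fun n m => ?_⟩
  have h1 := cktSize_pairVec n m
  have h2 := ((C (2 * n + 2 + m)).cktSize_eval (hC _).1).of_le (hC _).2
  refine (h1.comp h2).congr fun w _ => ?_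
  rw [← ofFn_pairVec]
  exact hdec.eval_eq _

/-! ### Recursive majority amplification -/

/-- `recMaj F k x ω`: the depth-`k` recursive majority-of-three of the verdicts `F x (ω c)` over
`3ᵏ` independent coin vectors `ω c`, indexed by paths `c : Fin k → Fin 3` (error reduction by
repetition and majority, Arora–Barak 2009, Thm. 7.10, in recursive form).
[cite: AroraBarakCC2009, Thm. 7.10] -/
def recMaj (F : (α → Bool) → (β → Bool) → Bool) :
    (k : ℕ) → (α → Bool) → ((Fin k → Fin 3) → β → Bool) → Bool
  | 0, x, ω => F x (ω Fin.elim0)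
  | k + 1, x, ω => maj3 (recMaj F k x fun c => ω (Fin.cons 0 c))
      (recMaj F k x fun c => ω (Fin.cons 1 c)) (recMaj F k x fun c => ω (Fin.cons 2 c))

/-- Gate count of the depth-`k` recursive majority over a size-`s` base circuit: `S₀ = s`,
`Sₖ₊₁ = 3 Sₖ + 4` (Arora–Barak 2009, Thm. 7.10, size of the repetition circuit).
[cite: AroraBarakCC2009, Thm. 7.10] -/
def recMajSize (s : ℕ) : ℕ → ℕ
  | 0 => s
  | k + 1 => 3 * recMajSize s k + 4

/-- Closed form `Sₖ + 2 = 3ᵏ (s + 2)` of the recursive-majority gate count (Arora–Barak 2009,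
Thm. 7.10). [cite: AroraBarakCC2009, Thm. 7.10] -/
theorem recMajSize_add_two (s k : ℕ) : recMajSize s k + 2 = 3 ^ k * (s + 2) := by
  induction k with
  | zero => simp [recMajSize]
  | succ k ih => simp only [recMajSize, pow_succ]; linarith

/-- **Step 2 (circuits).** The depth-`k` recursive majority of a size-`s` circuit has a
`B₂`-circuit of size `recMajSize s k` on the inputs `x` and the `3ᵏ · |β|` coin bits: three
rewired copies and one `MAJ₃` per level (Arora–Barak 2009, Thm. 7.10; Vollmer 1999, §1.2).
[cite: AroraBarakCC2009, Thm. 7.10] -/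
theorem cktSize_recMaj {F : (α → Bool) → (β → Bool) → Bool} {s : ℕ}
    (hF : CktSize B2 (fun (w : α ⊕ β → Bool) (_ : Unit) =>
      F (fun a => w (.inl a)) (fun b => w (.inr b))) s) :
    ∀ k : ℕ, CktSize B2 (fun (w : α ⊕ ((Fin k → Fin 3) × β) → Bool) (_ : Unit) =>
      recMaj F k (fun a => w (.inl a)) (fun c b => w (.inr (c, b)))) (recMajSize s k)
  | 0 => (hF.rewire (ι' := α ⊕ ((Fin 0 → Fin 3) × β))
      (Sum.elim Sum.inl fun b => Sum.inr (Fin.elim0, b))).congr fun w _ => rfl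
  | k + 1 => by
    have ih := cktSize_recMaj hF k
    have hcopy : ∀ i : Fin 3,
        CktSize B2 (fun (w : α ⊕ ((Fin (k + 1) → Fin 3) × β) → Bool) (_ : Unit) =>
          recMaj F k (fun a => w (.inl a)) (fun c b => w (.inr (Fin.cons i c, b))))
        (recMajSize s k) := fun i =>
      (ih.rewire (ι' := α ⊕ ((Fin (k + 1) → Fin 3) × β))
        (Sum.elim Sum.inl fun cb => Sum.inr (Fin.cons i cb.1, cb.2))).congr fun w _ => rfl
    have h3 := CktSize.pi_const (f := fun (w : α ⊕ ((Fin (k + 1) → Fin 3) × β) → Bool)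
      (i : Fin 3) => recMaj F k (fun a => w (.inl a)) (fun c b => w (.inr (Fin.cons i c, b))))
      hcopy
    have h4 := h3.comp (cktSize_maj3 (ι := Fin 3) 0 1 2)
    refine (h4.of_le ?_).congr fun w _ => rfl
    simp [recMajSize]

/-- **Step 4 (hardwiring).** Substituting constants `ω` for the inputs `γ` of a circuit costs
two extra (constant) gates over `B₂` (Arora–Barak 2009, proof of Thm. 7.14, "hardwire such a
string `r₀`"). [cite: AroraBarakCC2009, Thm. 7.14] -/
theorem CktSize.hardwire {f : (α ⊕ γ → Bool) → Unit → Bool} {s : ℕ}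
    (hf : CktSize B2 f s) (ω : γ → Bool) :
    CktSize B2 (fun (x : α → Bool) => f (Sum.elim x ω)) (s + 2) := by
  have h1 : CktSize B2 (fun (x : α → Bool) =>
      Sum.elim x (Sum.elim (fun (_ : Unit) => true) (fun (_ : Unit) => false))) (0 + (1 + 1)) :=
    (CktSize.id B2).pair ((cktSize_const α true).pair (cktSize_const α false))
  have h2 := hf.rewire (ι' := α ⊕ (Unit ⊕ Unit))
    (Sum.elim Sum.inl fun c => if ω c then Sum.inr (Sum.inl ()) else Sum.inr (Sum.inr ()))
  refine ((h1.comp h2).of_le (by omega)).congr fun x u => ?_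
  congr 1
  funext i
  cases i with
  | inl a => rfl
  | inr c =>
    simp only [Sum.elim_inr]
    cases ω c <;> rfl

/-! ### Counting: one round of majority-of-three -/

section Counting

variable {Ω : Type*} [Fintype Ω] [DecidableEq Ω]

/-- The truth table behind the error analysis of majority-of-three: if the majority of three
verdicts is wrong then two of them are wrong, in one of the three disjoint patterns
`(wrong, wrong, *)`, `(wrong, right, wrong)`, `(right, wrong, wrong)` (Arora–Barak 2009,
Thm. 7.10). [cite: AroraBarakCC2009, Thm. 7.10] -/
theorem maj3_ne_cases (a b d c : Bool) (h : maj3 a b d ≠ c) :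
    (a ≠ c ∧ b ≠ c) ∨ (a ≠ c ∧ ¬ b ≠ c ∧ d ≠ c) ∨ (¬ a ≠ c ∧ b ≠ c ∧ d ≠ c) := by
  revert a b d c
  decide

/-- **One round of majority-of-three, counted.** If `r : Ω → Bool` is wrong (`≠ c`) exactly on
`B`, then the number of triples `θ : Fin 3 → Ω` on which the majority of `r (θ 0), r (θ 1),
r (θ 2)` is wrong is at most `|B|²|Ω| + |B|(|Ω|-|B|)|B| + (|Ω|-|B|)|B|²`
(`= 3|B|²|Ω| - 2|B|³`) (error reduction, Arora–Barak 2009, Thm. 7.10, with an exact count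
instead of Chernoff).
[cite: AroraBarakCC2009, Thm. 7.10] -/
theorem card_maj3_wrong_le (r : Ω → Bool) (c : Bool) :
    #{θ : Fin 3 → Ω | maj3 (r (θ 0)) (r (θ 1)) (r (θ 2)) ≠ c} ≤
      #{ω | r ω ≠ c} * #{ω | r ω ≠ c} * Fintype.card Ω +
        (#{ω | r ω ≠ c} * (Fintype.card Ω - #{ω | r ω ≠ c}) * #{ω | r ω ≠ c} +
          (Fintype.card Ω - #{ω | r ω ≠ c}) * #{ω | r ω ≠ c} * #{ω | r ω ≠ c}) := by
  set B : Finset Ω := {ω | r ω ≠ c} with hB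
  have hBc : Bᶜ = ({ω | ¬ r ω ≠ c} : Finset Ω) := by
    ext ω; simp [B]
  have hsub : ({θ : Fin 3 → Ω | maj3 (r (θ 0)) (r (θ 1)) (r (θ 2)) ≠ c} : Finset _) ⊆
      Fintype.piFinset ![B, B, univ] ∪
        (Fintype.piFinset ![B, Bᶜ, B] ∪ Fintype.piFinset ![Bᶜ, B, B]) := by
    intro θ hθ
    simp only [mem_filter, mem_univ, true_and] at hθ
    have := maj3_ne_cases _ _ _ _ hθ
    simp only [mem_union, Fintype.mem_piFinset, Fin.forall_fin_succ, IsEmpty.forall_iff,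
      and_true, Matrix.cons_val_zero, Matrix.cons_val_succ, hBc, B, mem_filter, mem_univ,
      true_and]
    simpa using this
  refine (card_le_card hsub).trans ((card_union_le _ _).trans ?_)
  refine Nat.add_le_add ?_ ((card_union_le _ _).trans (Nat.add_le_add ?_ ?_)) <;>
    simp [Fintype.card_piFinset, Fin.prod_univ_three, Finset.card_compl]

end Counting

/-! ### The error of the recursive majority -/

section Error

variable (F : (α → Bool) → (β → Bool) → Bool) [Fintype β] [DecidableEq β]

/-- The coin vectors (at depth `k`) on which the recursive majority gives the verdict `≠ c`
("`r` is bad for `x`", Arora–Barak 2009, proof of Thm. 7.14).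
[cite: AroraBarakCC2009, Thm. 7.14] -/
def wrongSet (k : ℕ) (x : α → Bool) (c : Bool) : Finset ((Fin k → Fin 3) → β → Bool) :=
  {ω | recMaj F k x ω ≠ c}

/-- Splitting depth-`k + 1` coins into three families of depth-`k` coins along the first path
letter, `ω ↦ (i ↦ (c ↦ ω (i :: c)))` (currying; cf. Mathlib `Fin.consEquiv`). [folklore] -/
def splitCoins (k : ℕ) (γ : Type*) :
    ((Fin (k + 1) → Fin 3) → γ) ≃ (Fin 3 → (Fin k → Fin 3) → γ) where
  toFun ω i c := ω (Fin.cons i c)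
  invFun θ v := θ (v 0) (Fin.tail v)
  left_inv ω := funext fun v => by simp
  right_inv θ := funext fun i => funext fun c => by simp

/-- There are `T³` coin vectors of depth `k + 1` if there are `T` of depth `k`. [folklore] -/
theorem card_coins_succ (k : ℕ) :
    Fintype.card ((Fin (k + 1) → Fin 3) → β → Bool) =
      Fintype.card ((Fin k → Fin 3) → β → Bool) ^ 3 := by
  rw [Fintype.card_congr (splitCoins k (β → Bool)), Fintype.card_fun, Fintype.card_fin]

/-- There are `2^{|β|}` coin vectors of depth `0`. [folklore] -/
theorem card_coins_zero :
    Fintype.card ((Fin 0 → Fin 3) → β → Bool) = 2 ^ Fintype.card β := by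
  rw [Fintype.card_congr (Equiv.funUnique (Fin 0 → Fin 3) (β → Bool)), Fintype.card_fun,
    Fintype.card_bool]

/-- At depth `0` the wrong coin vectors are the coin strings `v` with `F x v ≠ c` (Arora–Barak
2009, proof of Thm. 7.14). [cite: AroraBarakCC2009, Thm. 7.14] -/
theorem card_wrongSet_zero (x : α → Bool) (c : Bool) :
    #(wrongSet F 0 x c) = #{v : β → Bool | F x v ≠ c} := by
  refine card_equiv (Equiv.funUnique (Fin 0 → Fin 3) (β → Bool)) fun ω => ?_
  simp only [wrongSet, recMaj, mem_filter, mem_univ, true_and, Equiv.funUnique_apply]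
  exact Iff.of_eq (congrArg (fun o : Fin 0 → Fin 3 => F x (ω o) ≠ c) (Subsingleton.elim _ _))

/-- The count of wrong depth-`k + 1` coin vectors in terms of depth `k`: `b' ≤ 3b²T - 2b³`
(written subtraction-free) (Arora–Barak 2009, Thm. 7.10, exact count).
[cite: AroraBarakCC2009, Thm. 7.10] -/
theorem card_wrongSet_succ_le (k : ℕ) (x : α → Bool) (c : Bool) :
    #(wrongSet F (k + 1) x c) ≤
      #(wrongSet F k x c) * #(wrongSet F k x c) * Fintype.card ((Fin k → Fin 3) → β → Bool) +
        (#(wrongSet F k x c) *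
            (Fintype.card ((Fin k → Fin 3) → β → Bool) - #(wrongSet F k x c)) *
            #(wrongSet F k x c) +
          (Fintype.card ((Fin k → Fin 3) → β → Bool) - #(wrongSet F k x c)) *
            #(wrongSet F k x c) * #(wrongSet F k x c)) := by
  have h := card_maj3_wrong_le (Ω := (Fin k → Fin 3) → β → Bool) (recMaj F k x) c
  have e : #(wrongSet F (k + 1) x c) =
      #{θ : Fin 3 → (Fin k → Fin 3) → β → Bool |
        maj3 (recMaj F k x (θ 0)) (recMaj F k x (θ 1)) (recMaj F k x (θ 2)) ≠ c} := by
    refine card_equiv (splitCoins k (β → Bool)) fun ω => ?_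
    simp [wrongSet, recMaj, splitCoins]
  rw [e]
  exact h

/-- The error of the depth-`k` recursive majority on input `x` against the verdict `c`: the
fraction of coin vectors giving `≠ c`, i.e. `Pr_r[M(x, r) ≠ c]` (Arora–Barak 2009, Def. 7.3
and proof of Thm. 7.14). [cite: AroraBarakCC2009, Thm. 7.14] -/
noncomputable def err (k : ℕ) (x : α → Bool) (c : Bool) : ℝ :=
  #(wrongSet F k x c) / Fintype.card ((Fin k → Fin 3) → β → Bool)

/-- The error is a probability: `0 ≤ err`. [folklore] -/
theorem err_nonneg (k : ℕ) (x : α → Bool) (c : Bool) : 0 ≤ err F k x c := by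
  unfold err; positivity

/-- The error is a probability: `err ≤ 1`. [folklore] -/
theorem err_le_one (k : ℕ) (x : α → Bool) (c : Bool) : err F k x c ≤ 1 := by
  unfold err
  rw [div_le_one (by exact_mod_cast Fintype.card_pos)]
  exact_mod_cast card_le_univ _

/-- **Step 2 (error recursion).** One round of majority-of-three maps error `e` to at most
`e² (3 - 2e)` (Arora–Barak 2009, Thm. 7.10, three repetitions counted exactly).
[cite: AroraBarakCC2009, Thm. 7.10] -/
theorem err_succ_le (k : ℕ) (x : α → Bool) (c : Bool) :
    err F (k + 1) x c ≤ (err F k x c) ^ 2 * (3 - 2 * err F k x c) := by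
  have h := card_wrongSet_succ_le F k x c
  unfold err
  rw [card_coins_succ]
  push_cast
  set b := #(wrongSet F k x c) with hb
  set t := Fintype.card ((Fin k → Fin 3) → β → Bool) with ht
  have hbt : b ≤ t := card_le_univ _
  have htpos : 0 < t := Fintype.card_pos
  have htposR : (0 : ℝ) < t := by exact_mod_cast htpos
  have h' : (#(wrongSet F (k + 1) x c) : ℝ) ≤ (b : ℝ) ^ 2 * (3 * t - 2 * b) := by
    have := (Nat.cast_le (α := ℝ)).2 h
    push_cast [Nat.cast_sub hbt] at this
    nlinarith [this]
  rw [div_le_iff₀ (pow_pos htposR 3)]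
  refine h'.trans (le_of_eq ?_)
  field_simp

/-- Monotonicity of `g(u) = u² (3 - 2u)` on `[0, 1]` (`g' = 6u(1-u) ≥ 0`). [folklore] -/
theorem sq_mul_three_sub_mono {u v : ℝ} (hu : 0 ≤ u) (huv : u ≤ v) (hv : v ≤ 1) :
    u ^ 2 * (3 - 2 * u) ≤ v ^ 2 * (3 - 2 * v) := by
  have h1 : 0 ≤ v - u := sub_nonneg.2 huv
  have hu1 : 0 ≤ 1 - u := by linarith
  have hv1 : 0 ≤ 1 - v := sub_nonneg.2 hv
  have hv0 : 0 ≤ v := hu.trans huv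
  nlinarith [mul_nonneg (mul_nonneg h1 hu) hu1, mul_nonneg (mul_nonneg h1 hv0) hv1,
    mul_nonneg (mul_nonneg h1 hu) hv1, mul_nonneg (mul_nonneg h1 hv0) hu1]

/-- **Numerics of the amplification.** From an initial error `≤ 1/3`, three rounds of `g` bring
the error to `≤ g(g(g(1/3))) < 1/6`, after which `3e ↦ (3e)²` dominates:
`3 e₃₊ⱼ ≤ 2^{-2^j}` (error `2^{-Ω(2^j)}` at cost `3^j`, cf. Arora–Barak 2009, Thm. 7.10).
[cite: AroraBarakCC2009, Thm. 7.10] -/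
theorem err_bound_of_rec (e : ℕ → ℝ) (h0 : e 0 ≤ 1 / 3) (hnn : ∀ k, 0 ≤ e k)
    (hrec : ∀ k, e (k + 1) ≤ (e k) ^ 2 * (3 - 2 * e k)) (j : ℕ) :
    3 * e (3 + j) ≤ (1 / 2) ^ (2 ^ j) := by
  have step : ∀ k (B : ℝ), e k ≤ B → B ≤ 1 → e (k + 1) ≤ B ^ 2 * (3 - 2 * B) :=
    fun k B hk hB => (hrec k).trans (sq_mul_three_sub_mono (hnn k) hk hB)
  have e1 := step 0 (1 / 3) h0 (by norm_num)
  have e2 := step 1 _ e1 (by norm_num)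
  have e3 := step 2 _ e2 (by norm_num)
  induction j with
  | zero => norm_num at e3 ⊢; linarith
  | succ j ih =>
    have := hrec (3 + j)
    rw [show 3 + (j + 1) = 3 + j + 1 by ring, pow_succ, pow_mul]
    have hsq : (3 * e (3 + j)) ^ 2 ≤ ((1 / 2 : ℝ) ^ 2 ^ j) ^ 2 :=
      pow_le_pow_left₀ (by linarith [hnn (3 + j)]) ih 2
    nlinarith [hnn (3 + j), sq_nonneg (e (3 + j))]

/-- The error of the depth-`3 + j` recursive majority is at most `2^{-2^j} / 3`, from an initial
error `≤ 1/3` (Arora–Barak 2009, Thm. 7.10). [cite: AroraBarakCC2009, Thm. 7.10] -/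
theorem err_le (x : α → Bool) (c : Bool) (h0 : err F 0 x c ≤ 1 / 3) (j : ℕ) :
    3 * err F (3 + j) x c ≤ (1 / 2) ^ (2 ^ j) :=
  err_bound_of_rec (fun k => err F k x c) h0 (fun k => err_nonneg F k x c)
    (fun k => err_succ_le F k x c) j

end Error

/-! ### Assembly: Adleman's theorem at the level of `P/poly` -/

/-- Wrong verdict bit versus wrong verdict: `[z ∈ L'] ≠ [x ∈ L] ↔ ¬ (z ∈ L' ↔ x ∈ L)`.
[folklore] -/
theorem boolIndicator_ne_boolIndicator_iff {L L' : Language Bool} (z x : List Bool) :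
    L'.boolIndicator z ≠ L.boolIndicator x ↔ ¬ (z ∈ L' ↔ x ∈ L) := by
  by_cases hz : z ∈ L' <;> by_cases hx : x ∈ L
  · rw [(Set.mem_iff_boolIndicator _ _).1 hz, (Set.mem_iff_boolIndicator _ _).1 hx]
    simp [hz, hx]
  · rw [(Set.mem_iff_boolIndicator _ _).1 hz, (Set.notMem_iff_boolIndicator _ _).1 hx]
    simp [hz, hx]
  · rw [(Set.notMem_iff_boolIndicator _ _).1 hz, (Set.mem_iff_boolIndicator _ _).1 hx]
    simp [hz, hx]
  · rw [(Set.notMem_iff_boolIndicator _ _).1 hz, (Set.notMem_iff_boolIndicator _ _).1 hx]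
    simp [hz, hx]

/-- **Base case.** The `bp` acceptance condition `Pr_y[[⟨x,y⟩ ∈ L'] = [x ∈ L]] ≥ 2/3` says
that the depth-`0` error is at most `1/3` (Arora–Barak 2009, Def. 7.3).
[cite: AroraBarakCC2009, Def. 7.3] -/
theorem err_zero_le_third {L L' : Language Bool} {n m : ℕ} (u : Fin n → Bool)
    (h : 2 / 3 ≤ uniformProb m
      {y : List Bool | boolPair (List.ofFn u) y ∈ L' ↔ List.ofFn u ∈ L}) :
    err (fun (u : Fin n → Bool) (v : Fin m → Bool) =>
        L'.boolIndicator (boolPair (List.ofFn u) (List.ofFn v))) 0 u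
      (L.boolIndicator (List.ofFn u)) ≤ 1 / 3 := by
  classical
  unfold err
  rw [card_wrongSet_zero, card_coins_zero, Fintype.card_fin]
  unfold uniformProb at h
  set good : (Fin m → Bool) → Prop := fun v =>
    boolPair (List.ofFn u) (List.ofFn v) ∈ L' ↔ List.ofFn u ∈ L with hgood
  -- name the finset of good coin strings appearing in `h` (whatever its decidability instance)
  obtain ⟨S, hS, hSmem⟩ : ∃ S : Finset (List.Vector Bool m), (2 / 3 : ℝ) ≤ #S / 2 ^ m ∧
      ∀ r, r ∈ S ↔ good r.get := ⟨_, h, fun r => by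
    simp only [mem_filter, mem_univ, true_and, Set.mem_setOf_eq, good]
    rw [← List.Vector.toList_ofFn r.get, List.Vector.ofFn_get]⟩
  have hG : #{v : Fin m → Bool | good v} = #S := by
    refine card_equiv (Equiv.vectorEquivFin Bool m).symm fun v => ?_
    rw [hSmem]
    simp only [mem_filter, mem_univ, true_and, Equiv.vectorEquivFin, Equiv.coe_fn_symm_mk]
    rw [show (List.Vector.ofFn v).get = v from funext (List.Vector.get_ofFn v)]
  have hW : #{v : Fin m → Bool | L'.boolIndicator (boolPair (List.ofFn u) (List.ofFn v)) ≠
      L.boolIndicator (List.ofFn u)} = #{v : Fin m → Bool | ¬ good v} := by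
    congr 1
    ext v
    simp [good, boolIndicator_ne_boolIndicator_iff]
  have hsplit := card_filter_add_card_filter_not (s := (univ : Finset (Fin m → Bool))) good
  rw [card_univ, Fintype.card_fun, Fintype.card_bool, Fintype.card_fin] at hsplit
  rw [hW]
  have h2m : (0 : ℝ) < 2 ^ m := by positivity
  rw [le_div_iff₀ h2m] at hS
  rw [Nat.cast_pow, Nat.cast_ofNat, div_le_iff₀ h2m]
  have hs : (#{v : Fin m → Bool | good v} : ℝ) + #{v : Fin m → Bool | ¬ good v} = 2 ^ m := by
    exact_mod_cast hsplit
  rw [hG] at hs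
  linarith

/-- **Step 3 (union bound).** If for each of the `2ⁿ` inputs at most a `2^{-2^j}/3` fraction of
the coin vectors is wrong, and `n ≤ 2^j`, then some coin vector is right for all inputs
simultaneously: `2ⁿ · 2^{-2^j}/3 < 1` (Arora–Barak 2009, proof of Thm. 7.14, "there exists a
string `r₀` that is good for every `x`"). [cite: AroraBarakCC2009, Thm. 7.14] -/
theorem exists_forall_notMem_of_small {n j : ℕ} {Ω : Type*} [Fintype Ω] [DecidableEq Ω]
    [Nonempty Ω] (wrong : (Fin n → Bool) → Finset Ω) (hj : n ≤ 2 ^ j)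
    (hsmall : ∀ u, 3 * ((#(wrong u) : ℝ) / Fintype.card Ω) ≤ (1 / 2) ^ (2 ^ j)) :
    ∃ ω : Ω, ∀ u, ω ∉ wrong u := by
  set T := Fintype.card Ω with hT
  have hTpos : (0 : ℝ) < T := by exact_mod_cast Fintype.card_pos
  have hpow : (2 : ℝ) ^ n * (1 / 2) ^ (2 ^ j) ≤ 1 := by
    have h1 : ((1 : ℝ) / 2) ^ (2 ^ j) ≤ (1 / 2) ^ n :=
      pow_le_pow_of_le_one (by norm_num) (by norm_num) hj
    have h2 : (2 : ℝ) ^ n * (1 / 2) ^ n = 1 := by rw [← mul_pow]; norm_num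
    nlinarith [pow_pos (show (0 : ℝ) < 2 by norm_num) n]
  have hsum : (∑ u : Fin n → Bool, (#(wrong u) : ℝ)) < T := by
    have hle : ∀ u : Fin n → Bool, (#(wrong u) : ℝ) ≤ T * (1 / 2) ^ (2 ^ j) / 3 := by
      intro u
      have := hsmall u
      rw [mul_div_assoc', div_le_iff₀ hTpos] at this
      linarith
    calc (∑ u : Fin n → Bool, (#(wrong u) : ℝ))
        ≤ ∑ _u : Fin n → Bool, (T : ℝ) * (1 / 2) ^ (2 ^ j) / 3 :=
          sum_le_sum fun u _ => hle u
      _ = 2 ^ n * (1 / 2) ^ (2 ^ j) * T / 3 := by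
        rw [sum_const, card_univ, Fintype.card_fun, Fintype.card_bool, Fintype.card_fin]
        simp; ring
      _ ≤ 1 * T / 3 := by gcongr
      _ < T := by linarith
  have hlt : #((univ : Finset (Fin n → Bool)).biUnion wrong) < #(univ : Finset Ω) := by
    have h1 := card_biUnion_le (s := (univ : Finset (Fin n → Bool))) (t := wrong)
    have h2 : ((∑ u : Fin n → Bool, #(wrong u) : ℕ) : ℝ) < T := by push_cast; exact hsum
    rw [card_univ]
    exact_mod_cast lt_of_le_of_lt (Nat.cast_le.2 h1) h2
  obtain ⟨ω, -, hω⟩ := exists_mem_notMem_of_card_lt_card hlt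
  refine ⟨ω, fun u hu => hω ?_⟩
  exact mem_biUnion.2 ⟨u, mem_univ _, hu⟩

/-- Size arithmetic: `3^{⌊log₂ n⌋ + 1} ≤ 4^{⌊log₂ n⌋ + 1} ≤ (2n + 2)²`. [folklore] -/
theorem three_pow_log_succ_le (n : ℕ) : 3 ^ (Nat.log 2 n + 1) ≤ (2 * n + 2) ^ 2 := by
  have h1 : 3 ^ (Nat.log 2 n + 1) ≤ 4 ^ (Nat.log 2 n + 1) :=
    Nat.pow_le_pow_left (by norm_num) _
  have h2 : 4 ^ (Nat.log 2 n + 1) = (2 ^ (Nat.log 2 n + 1)) ^ 2 := by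
    rw [← pow_mul, mul_comm, pow_mul]; norm_num
  have h3 : 2 ^ (Nat.log 2 n + 1) ≤ 2 * n + 2 := by
    rcases Nat.eq_zero_or_pos n with rfl | hn
    · simp
    · have := Nat.pow_log_le_self 2 hn.ne'
      rw [pow_succ]; omega
  calc 3 ^ (Nat.log 2 n + 1) ≤ (2 ^ (Nat.log 2 n + 1)) ^ 2 := h2 ▸ h1
    _ ≤ (2 * n + 2) ^ 2 := Nat.pow_le_pow_left h3 2

/-- **Adleman's theorem for the `BP` operator on `P/poly`**: `BP·(P/poly) ⊆ P/poly`. Given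
`L ∈ bp PPoly` via `L' ∈ P/poly` (circuits of size `q`) and coin length `p(n)`: amplify by
recursive majority-of-three to error `≤ 2^{-2^j}/3` with `2^j > n` (depth `3 + j`,
`j = ⌊log₂ n⌋ + 1`, size factor `3^{3+j} ≤ 27 (2n+2)²`), fix by the union bound one coin
vector correct on all `2ⁿ` inputs of length `n`, and hardwire it; the size polynomial is
`27 (2X+2)² ((2X+2+p) + q ∘ (2X+2+p) + 2)` (Adleman 1978; Arora–Barak 2009, proof of Thm. 7.14,
p. 136). [cite: AroraBarakCC2009, Thm. 7.14] -/
theorem bp_PPoly_subset_PPoly : bp PPoly ⊆ PPoly := by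
  classical
  rintro L ⟨L', hL', p, hp⟩
  obtain ⟨q, hq⟩ := exists_cktSize_boolPair_of_mem_PPoly hL'
  let Np : Polynomial ℕ := 2 * X + 2 + p
  let r : Polynomial ℕ := 27 * (2 * X + 2) ^ 2 * (Np + q.comp Np + 2)
  have hr : ∀ n, r.eval n = 27 * (2 * n + 2) ^ 2 *
      ((2 * n + 2 + p.eval n) + q.eval (2 * n + 2 + p.eval n) + 2) := by
    intro n
    simp [r, Np, eval_comp]
  have main : ∀ n : ℕ, ∃ D : Circuit (Fin n), D.IsOver B2 ∧ D.size ≤ r.eval n ∧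
      ∀ u : Fin n → Bool, D.eval u = L.boolIndicator (List.ofFn u) := by
    intro n
    set m := p.eval n with hm
    set F : (Fin n → Bool) → (Fin m → Bool) → Bool := fun u v =>
      L'.boolIndicator (boolPair (List.ofFn u) (List.ofFn v)) with hF_def
    set c : (Fin n → Bool) → Bool := fun u => L.boolIndicator (List.ofFn u) with hc_def
    have hF : CktSize B2 (fun (w : Fin n ⊕ Fin m → Bool) (_ : Unit) =>
        F (fun a => w (.inl a)) (fun b => w (.inr b))) _ := hq n m
    set j := Nat.log 2 n + 1 with hj
    have hK := cktSize_recMaj hF (3 + j)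
    -- error bound at depth `3 + j`
    have herr : ∀ u, 3 * err F (3 + j) u (c u) ≤ (1 / 2) ^ (2 ^ j) := fun u =>
      err_le F u (c u) (err_zero_le_third u (by simpa using hp (List.ofFn u))) j
    -- one coin vector good for all inputs
    obtain ⟨ω, hω⟩ : ∃ ω : (Fin (3 + j) → Fin 3) → Fin m → Bool,
        ∀ u, ω ∉ wrongSet F (3 + j) u (c u) :=
      exists_forall_notMem_of_small (fun u => wrongSet F (3 + j) u (c u))
        (Nat.lt_pow_succ_log_self one_lt_two n).le fun u => herr u
    have hωc : ∀ u, recMaj F (3 + j) u ω = c u := fun u => by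
      simpa [wrongSet] using hω u
    -- hardwire it
    obtain ⟨D, hDB, hDs, hDe⟩ :=
      (hK.hardwire fun cb : (Fin (3 + j) → Fin 3) × Fin m => ω cb.1 cb.2).toCircuit
    refine ⟨D, hDB, hDs.trans ?_, fun u => (hDe u).trans (hωc u)⟩
    rw [recMajSize_add_two, hr n, pow_add]
    have h3 := three_pow_log_succ_le n
    have : 3 ^ 3 * 3 ^ j * (2 * n + 2 + m + q.eval (2 * n + 2 + m) + 2) ≤
        27 * (2 * n + 2) ^ 2 * (2 * n + 2 + m + q.eval (2 * n + 2 + m) + 2) := by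
      gcongr
      norm_num
    simpa [hm] using this
  choose D hD using main
  refine Set.mem_iUnion.2 ⟨r, D, fun n => ⟨(hD n).1, (hD n).2.1⟩, fun x => ?_⟩
  have := (hD x.length).2.2 x.get
  rwa [List.ofFn_get] at this

/-- **Adleman's theorem, relative to `P ⊆ P/poly`**: `P_subset_PPoly → BPP_subset_PPoly`,
since `BPP = bp P ⊆ bp (P/poly) ⊆ P/poly` (Adleman 1978; Arora–Barak 2009, Thm. 7.14 from
Thm. 6.6, p. 136). Feeding `P_subset_PPoly_holds` (Thm. 6.6, the machine-to-circuit
simulation) gives the absolute discharge `BPP_subset_PPoly_holds`.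
[cite: Adleman1978, Thm. 7.14 (p. 136) of AroraBarakCC2009] -/
theorem BPP_subset_PPoly_of_P_subset_PPoly (h : P_subset_PPoly) : BPP_subset_PPoly :=
  (bp_mono h).trans bp_PPoly_subset_PPoly

end Literature.Computability.Complexity
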